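import Literature.AlgebraicGeometry.Motives.LinesGenerateChowOne
import HarnessLib

/-!
# `CH₂` of a smooth cubic hypersurface of large dimension is generated by planes (Mboro)

R. Mboro, *Remarks on the `CH₂` of cubic hypersurfaces*, Geom. Dedicata 200 (2018)
[Mboro2018] = arXiv:1701.04488 (read: arXiv text, Introduction pp. 3–4 and §2, Cor. 2.9 p. 12).
Corollary 6 of the Introduction (= Corollary 2.9 of the body; "Cor. 0.6" in the journal numbering
used by the requesting route):

> Let `X ⊂ ℙⁿ⁺¹_k` be a smooth cubic hypersurface over an algebraically closed field `k` of
> characteristic `0`. If `n ≥ 7`, then `CH₂(X)` is generated by classes of planes `ℙ² ⊂ X` and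
> therefore `CH₂(X)_hom = CH₂(X)_alg`. If `n ≥ 9`, then `CH₂(X) ≃ ℤ`.

(Cor. 2.9: "(i) if `dim_k(X) ≥ 7`, then, `CH₂(X)` is generated (over `ℤ`) by cycle classes of planes
contained in `X` and `CH₂(X)_hom = CH₂(X)_alg`; (ii) if `dim_k(X) ≥ 9`, then, `CH₂(X) ≃ ℤ`".)

This file

* generalises the "lines of `X ⊆ ℙᴺ`" vocabulary of `Motives/LinesGenerateChowOne`
  (`IsLinePoint`, `lineClasses`, `ChowOneGeneratedByLines`) from lines to **linear subspaces of
  dimension `r`** (`IsLinearSubspacePoint r N i z`: `z` has dimension `r` and the image of its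
  closure under `i : X ⟶ ℙᴺ_k` is `V₊(L₁, …, L_{N-r})` for `N - r` linearly independent linear
  forms; `linearSubspaceClasses`, `ChowGeneratedByLinearSubspaces`), with the same proved
  dictionary between the cycle-level rendering and `AddSubgroup.closure (classes) = ⊤`
  (`chowGeneratedByLinearSubspaces_iff_closure_eq_top`) and the identification with lines for
  `r = 1` (`isLinePoint_iff_isLinearSubspacePoint_one`);
* vendors **Corollary 6 = 2.9** as the named fact `Mboro2018_chowTwo_cubic` (D-0014): for a smooth
  cubic hypersurface `X ⊆ ℙⁿ⁺¹_k`, `k` algebraically closed of characteristic `0` — spelled by the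
  constituents of `IsSmoothHypersurface n 3 X` (`Motives/Sweep1`) with the embedding exposed
  (`IsSmoothProjective n X`, an irreducible cubic form `F`, a closed `k`-immersion
  `i : X ↪ ℙⁿ⁺¹_k` with image `V₊(F)`), planes being taken with respect to `i` —
  (i) `7 ≤ n →` every `2`-cycle is rationally equivalent to an integral combination of planes
  (`ChowGeneratedByLinearSubspaces 2 (n + 1) i`), and (ii) `9 ≤ n → CH₂(X) ≃ ℤ`
  (`Nonempty (ChowGroup X.left 2 ≃+ ℤ)`).

## Scope (what is NOT vendored)

* The clause "`CH₂(X)_hom = CH₂(X)_alg`" of Cor. 6 (no homological equivalence on the tree's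
  `ChowGroup`).
* **Theorem 2 of the Introduction (= journal Thm. 0.2; body Thm. 1.3)** — for `n ≥ 2ⁱ + 1`, `X`
  containing a linear subspace of dimension `i < n/2`, `char k ≠ 2`, and granting resolution of
  singularities in dimension `≤ i`, the universal-line correspondence
  `P_{1,*} : CH_{i-1}(F₁(X)) → CH_i(X)` is surjective — and Cor. 3 (`n ≥ 5`: `CH₂(X)` generated by
  rational surfaces): these need the Fano scheme of lines `F₁(X)` with its universal `ℙ¹`-bundle
  (definition request `FanoSchemeOfLines`, not yet in the tree) and a notion of rational surface.
* Theorems 5, 8, 9 (one-cycles on `F₁(X)`, Shen-type formula, torsion).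

## References

* [Mboro2018] R. Mboro, *Remarks on the `CH₂` of cubic hypersurfaces*, Geom. Dedicata 200
  (2018); arXiv:1701.04488: Introduction, Cor. 6 (p. 4) = Cor. 2.9 (p. 12), Thm. 2 (p. 3).
* [TianZong2014] Z. Tian, H. R. Zong, *One-cycles on rationally connected varieties*, Compositio
  Math. 150 (2014) — the `r = 1` vocabulary of `Motives/LinesGenerateChowOne`.
* W. Fulton, *Intersection Theory*, §1.3 (cycles, rational equivalence). [Fulton1998]
-/

noncomputable section

open CategoryTheory AlgebraicGeometry

universe u

namespace Literature.AlgebraicGeometry.Motives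

attribute [local instance] MvPolynomial.gradedAlgebra

/-! ### Linear subspaces of dimension `r` on an embedded projective `k`-scheme -/

section LinearSubspaces

variable {k : Type u} [Field k]

/-- **Linear subspaces of dimension `r` of `X ⊆ ℙᴺ_k`.** For a `k`-scheme `X` with a
`k`-morphism `i : X ⟶ ℙᴺ_k` (a closed immersion in all uses), the point `z` of `X` *is (the generic
point of) an `r`-plane of `X`* if its closure is `r`-dimensional (`Order.height z = r` in the
specialisation order, the grading of `cyclesOfDim X r`) and is mapped by `i` onto a linear subspace
`V₊(L₁, …, L_{N-r}) ⊆ ℙᴺ = Proj k[x₀, …, x_N]` cut out by `N - r` linearly independent linear forms,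
i.e. onto an `r`-plane of `ℙᴺ` (meant for `r ≤ N`; `N - r` is `ℕ`-subtraction). For `r = 1` this
is `IsLinePoint` (`isLinePoint_iff_isLinearSubspacePoint_one`); `r = 2` are the planes `ℙ² ⊂ X` of
Mboro's Cor. 6. Its class in `CH_r(X)` is the class of `primeCycle z` (Fulton §1.3). [folklore] -/
def IsLinearSubspacePoint (r N : ℕ) {X : SchemeOver k} (i : X ⟶ projectiveSpace N k)
    (z : ↥X.left) : Prop :=
  Order.height z = r ∧
    ∃ L : Fin (N - r) → MvPolynomial (Fin (N + 1)) k, LinearIndependent k L ∧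
      (∀ j, (L j).IsHomogeneous 1) ∧
        ⇑i.left.base '' closure {z} =
          ProjectiveSpectrum.zeroLocus (MvPolynomial.homogeneousSubmodule (Fin (N + 1)) k)
            (Set.range L)

variable {r N : ℕ} {X : SchemeOver k} {i : X ⟶ projectiveSpace N k}

/-- Unfolding of `IsLinearSubspacePoint` (`Iff.rfl`). [folklore] -/
theorem isLinearSubspacePoint_iff (z : ↥X.left) :
    IsLinearSubspacePoint r N i z ↔ Order.height z = r ∧
      ∃ L : Fin (N - r) → MvPolynomial (Fin (N + 1)) k, LinearIndependent k L ∧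
        (∀ j, (L j).IsHomogeneous 1) ∧
          ⇑i.left.base '' closure {z} =
            ProjectiveSpectrum.zeroLocus (MvPolynomial.homogeneousSubmodule (Fin (N + 1)) k)
              (Set.range L) :=
  Iff.rfl

/-- Lines are the linear subspaces of dimension `1`: `IsLinePoint N i z ↔
IsLinearSubspacePoint 1 N i z`. [folklore] -/
theorem isLinePoint_iff_isLinearSubspacePoint_one (z : ↥X.left) :
    IsLinePoint N i z ↔ IsLinearSubspacePoint 1 N i z := by
  simp only [IsLinePoint, IsLinearSubspacePoint, Nat.cast_one]

/-- The generic point of an `r`-plane has dimension `r`. [folklore] -/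
theorem IsLinearSubspacePoint.height_eq {z : ↥X.left} (h : IsLinearSubspacePoint r N i z) :
    Order.height z = r :=
  h.1

/-- The prime cycle of an `r`-plane is an `r`-cycle. [folklore] -/
theorem IsLinearSubspacePoint.primeCycle_mem {z : ↥X.left} (h : IsLinearSubspacePoint r N i z) :
    primeCycle z ∈ cyclesOfDim X.left r :=
  primeCycle_mem_cyclesOfDim h.height_eq

/-- Integral combinations of prime cycles of `r`-planes are `r`-cycles. [folklore] -/
theorem sum_zsmul_primeCycle_mem_cyclesOfDim_of_isLinearSubspacePoint {s : Finset ↥X.left}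
    (w : ↥X.left → ℤ) (hs : ∀ z ∈ s, IsLinearSubspacePoint r N i z) :
    (∑ z ∈ s, w z • primeCycle z) ∈ cyclesOfDim X.left r :=
  AddSubgroup.sum_mem _ fun z hz => AddSubgroup.zsmul_mem _ (hs z hz).primeCycle_mem _

/-- The set of **`r`-plane classes** `[Λ] ∈ CH_r(X)`: classes `ChowGroup.ofPoint z _` of the prime
cycles of the `r`-planes `z` of `X ⊆ ℙᴺ` (Fulton §1.3). [folklore] -/
def linearSubspaceClasses (r N : ℕ) {X : SchemeOver k} (i : X ⟶ projectiveSpace N k) :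
    Set (ChowGroup X.left r) :=
  {x | ∃ (z : ↥X.left) (hz : IsLinearSubspacePoint r N i z), x = ChowGroup.ofPoint z hz.height_eq}

/-- The class of an `r`-plane is an `r`-plane class. [folklore] -/
theorem ofPoint_mem_linearSubspaceClasses {z : ↥X.left} (hz : IsLinearSubspacePoint r N i z) :
    ChowGroup.ofPoint z hz.height_eq ∈ linearSubspaceClasses r N i :=
  ⟨z, hz, rfl⟩

/-- **`CH_r(X)` is generated by `r`-planes** (a PREDICATE of the embedded scheme `i : X ⟶ ℙᴺ`),
rendered on cycles: every `r`-cycle `γ ∈ Z_r(X)` is rationally equivalent (as an `r`-cycle,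
Fulton §1.3) to an integral combination `∑_{z ∈ s} w z • [closure {z}]` of prime cycles of finitely
many `r`-planes `z` of `X ⊆ ℙᴺ`. Equivalent to `AddSubgroup.closure (linearSubspaceClasses r N i)
= ⊤` (`chowGeneratedByLinearSubspaces_iff_closure_eq_top`). [folklore] -/
def ChowGeneratedByLinearSubspaces (r N : ℕ) {X : SchemeOver k} (i : X ⟶ projectiveSpace N k) :
    Prop :=
  ∀ γ ∈ cyclesOfDim X.left r, ∃ (s : Finset ↥X.left) (w : ↥X.left → ℤ),
    (∀ z ∈ s, IsLinearSubspacePoint r N i z) ∧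
      IsRationallyEquivalent γ (∑ z ∈ s, w z • primeCycle z) r

/-- For `r = 1`, "generated by `1`-planes" is "generated by lines" (`ChowOneGeneratedByLines`).
[folklore] -/
theorem chowGeneratedByLinearSubspaces_one_iff :
    ChowGeneratedByLinearSubspaces 1 N i ↔ ChowOneGeneratedByLines N i := by
  simp only [ChowGeneratedByLinearSubspaces, ChowOneGeneratedByLines,
    isLinePoint_iff_isLinearSubspacePoint_one]

/-- The class of an integral combination of prime cycles of `r`-planes lies in the subgroup
generated by the `r`-plane classes. [folklore] -/
theorem mk_sum_zsmul_primeCycle_mem_closure_linearSubspaceClasses {s : Finset ↥X.left}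
    (w : ↥X.left → ℤ) (hs : ∀ z ∈ s, IsLinearSubspacePoint r N i z) :
    ChowGroup.mk X.left r ⟨∑ z ∈ s, w z • primeCycle z,
        sum_zsmul_primeCycle_mem_cyclesOfDim_of_isLinearSubspacePoint w hs⟩ ∈
      AddSubgroup.closure (linearSubspaceClasses r N i) := by
  have : (⟨∑ z ∈ s, w z • primeCycle z,
      sum_zsmul_primeCycle_mem_cyclesOfDim_of_isLinearSubspacePoint w hs⟩ :
      ↥(cyclesOfDim X.left r)) =
      ∑ z ∈ s.attach, w z • ⟨primeCycle (z : ↥X.left), (hs z z.2).primeCycle_mem⟩ := by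
    apply Subtype.ext
    rw [AddSubgroup.val_finsetSum]
    simp only [AddSubgroup.coe_zsmul]
    exact (Finset.sum_attach s (fun z => w z • primeCycle z)).symm
  rw [this, map_sum]
  refine AddSubgroup.sum_mem _ fun z _ => ?_
  rw [map_zsmul]
  exact AddSubgroup.zsmul_mem _
    (AddSubgroup.subset_closure (k := linearSubspaceClasses r N i) ⟨z, hs z z.2, rfl⟩) _

/-- Cycle level ⇒ Chow-group level: if every `r`-cycle is rationally equivalent to an integral
combination of `r`-planes, the `r`-plane classes generate `CH_r(X)`. [folklore] -/
theorem ChowGeneratedByLinearSubspaces.closure_eq_top (h : ChowGeneratedByLinearSubspaces r N i) :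
    AddSubgroup.closure (linearSubspaceClasses r N i) = ⊤ := by
  rw [eq_top_iff]
  rintro x -
  induction x using ChowGroup.induction_on with
  | h γ =>
    obtain ⟨s, w, hs, hrat⟩ := h γ γ.2
    have hmk : ChowGroup.mk X.left r γ =
        ChowGroup.mk X.left r ⟨_, sum_zsmul_primeCycle_mem_cyclesOfDim_of_isLinearSubspacePoint
          w hs⟩ :=
      ChowGroup.mk_eq_mk_iff.mpr hrat
    rw [hmk]
    exact mk_sum_zsmul_primeCycle_mem_closure_linearSubspaceClasses w hs

/-- An element of the subgroup of `CH_r(X)` generated by the `r`-plane classes is the class of an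
integral combination of prime cycles of finitely many `r`-planes (bookkeeping by
`AddSubgroup.closure_induction`). [folklore] -/
theorem exists_eq_mk_sum_of_mem_closure_linearSubspaceClasses {x : ChowGroup X.left r}
    (hx : x ∈ AddSubgroup.closure (linearSubspaceClasses r N i)) :
    ∃ (s : Finset ↥X.left) (w : ↥X.left → ℤ) (hs : ∀ z ∈ s, IsLinearSubspacePoint r N i z),
      x = ChowGroup.mk X.left r ⟨∑ z ∈ s, w z • primeCycle z,
        sum_zsmul_primeCycle_mem_cyclesOfDim_of_isLinearSubspacePoint w hs⟩ := by
  classical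
  induction hx using AddSubgroup.closure_induction with
  | mem x hx =>
    obtain ⟨z, hz, rfl⟩ := hx
    refine ⟨{z}, fun _ => 1, by simpa using hz, ?_⟩
    simp only [ChowGroup.ofPoint]
    congr 1
    exact Subtype.ext (by simp)
  | zero =>
    refine ⟨∅, 0, by simp, ?_⟩
    have h0 : (⟨∑ z ∈ (∅ : Finset ↥X.left), (0 : ↥X.left → ℤ) z • primeCycle z,
        sum_zsmul_primeCycle_mem_cyclesOfDim_of_isLinearSubspacePoint (r := r) (N := N) (i := i)
          0 (by simp)⟩ : ↥(cyclesOfDim X.left r)) = 0 :=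
      Subtype.ext (by simp)
    rw [h0, map_zero]
  | add x y _ _ ihx ihy =>
    obtain ⟨s₁, w₁, hs₁, rfl⟩ := ihx
    obtain ⟨s₂, w₂, hs₂, rfl⟩ := ihy
    have hs : ∀ z ∈ s₁ ∪ s₂, IsLinearSubspacePoint r N i z := by
      intro z hz
      rcases Finset.mem_union.mp hz with hz | hz
      exacts [hs₁ z hz, hs₂ z hz]
    refine ⟨s₁ ∪ s₂, fun z => (if z ∈ s₁ then w₁ z else 0) + (if z ∈ s₂ then w₂ z else 0), hs, ?_⟩
    rw [← map_add]
    congr 1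
    apply Subtype.ext
    simp only [AddSubgroup.coe_add, add_zsmul, Finset.sum_add_distrib, ite_smul, zero_smul,
      Finset.sum_ite_mem, Finset.union_inter_cancel_left, Finset.union_inter_cancel_right]
  | neg x _ ih =>
    obtain ⟨s, w, hs, rfl⟩ := ih
    refine ⟨s, fun z => -w z, hs, ?_⟩
    rw [← map_neg]
    congr 1
    apply Subtype.ext
    simp only [AddSubgroup.coe_neg, neg_zsmul, Finset.sum_neg_distrib]

/-- Chow-group level ⇒ cycle level. [folklore] -/
theorem chowGeneratedByLinearSubspaces_of_closure_eq_top
    (h : AddSubgroup.closure (linearSubspaceClasses r N i) = ⊤) :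
    ChowGeneratedByLinearSubspaces r N i := by
  intro γ hγ
  have hx : ChowGroup.mk X.left r ⟨γ, hγ⟩ ∈ AddSubgroup.closure (linearSubspaceClasses r N i) := by
    rw [h]; trivial
  obtain ⟨s, w, hs, hmk⟩ := exists_eq_mk_sum_of_mem_closure_linearSubspaceClasses hx
  exact ⟨s, w, hs, ChowGroup.mk_eq_mk_iff.mp hmk⟩

/-- **Equivalence of the two readings of "`CH_r(X)` is generated by `r`-planes"**: the cycle-level
rendering holds iff the subgroup of `CH_r(X) = Z_r(X)/Rat_r(X)` generated by the classes of
`r`-planes is all of `CH_r(X)`. [folklore] -/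
theorem chowGeneratedByLinearSubspaces_iff_closure_eq_top :
    ChowGeneratedByLinearSubspaces r N i ↔ AddSubgroup.closure (linearSubspaceClasses r N i) = ⊤ :=
  ⟨ChowGeneratedByLinearSubspaces.closure_eq_top, chowGeneratedByLinearSubspaces_of_closure_eq_top⟩

end LinearSubspaces

/-! ### The named fact -/

/-- **Mboro, Cor. 6 of the Introduction (= Cor. 2.9; journal Cor. 0.6).** *Let `X ⊂ ℙⁿ⁺¹_k` be a
smooth cubic hypersurface over an algebraically closed field `k` of characteristic `0`. If `n ≥ 7`,
then `CH₂(X)` is generated by classes of planes `ℙ² ⊂ X` (and therefore `CH₂(X)_hom = CH₂(X)_alg`).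
If `n ≥ 9`, then `CH₂(X) ≃ ℤ`* (arXiv:1701.04488, p. 4 and p. 12: "generated (over `ℤ`) by cycle
classes of planes contained in `X`"; from Thm. 5/2.8 — `CH₁(F₁(X))` is generated by lines for
`d(d+1)/2 < n` — and Prop. 1.4/Thm. 1.3 on the universal line).

Rendering. "Smooth cubic hypersurface `X ⊂ ℙⁿ⁺¹_k`" is spelled by the constituents of
`IsSmoothHypersurface n 3 X` (`Motives/Sweep1`) with the embedding exposed, because "plane of `X`"
refers to it: `X` smooth projective geometrically integral of dimension `n`
(`IsSmoothProjective n X`), an irreducible cubic form `F` on `ℙⁿ⁺¹`, and a closed `k`-immersion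
`i : X ↪ ℙⁿ⁺¹_k` with image `V₊(F)` (reducedness, part of `IsHypersurfaceCutOutBy`, is automatic
for smooth `X`). (i) `7 ≤ n`: every `2`-cycle on `X` is rationally equivalent to an integral
combination of prime cycles of planes of `X ⊆ ℙⁿ⁺¹` (`ChowGeneratedByLinearSubspaces 2 (n + 1) i`;
equivalently the plane classes generate `CH₂(X)`, `chowGeneratedByLinearSubspaces_iff_closure_eq_top`).
(ii) `9 ≤ n`: `CH₂(X) ≃ ℤ` as an abelian group. The clause `CH₂(X)_hom = CH₂(X)_alg` is not
vendored. The instance wanted by the route `ConiveauLadderCubicEightfolds` is `k = ℂ`, `n = 8`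
(clause (i)). [cite: Mboro2018, Cor. 0.6 (= arXiv:1701.04488 Intro. Cor. 6, p. 4; Cor. 2.9, p. 12)] -/
def Mboro2018_chowTwo_cubic : Prop :=
  ∀ ⦃k : Type u⦄ [Field k] [IsAlgClosed k] [CharZero k] (n : ℕ) ⦃X : SchemeOver k⦄
    (F : MvPolynomial (Fin (n + 1 + 1)) k) (i : X ⟶ projectiveSpace (n + 1) k),
    IsSmoothProjective n X → F.IsHomogeneous 3 → Irreducible F → IsClosedImmersion i.left →
      Set.range i.left.base =
        ProjectiveSpectrum.zeroLocus (MvPolynomial.homogeneousSubmodule (Fin (n + 1 + 1)) k) {F} →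
      (7 ≤ n → ChowGeneratedByLinearSubspaces 2 (n + 1) i) ∧
        (9 ≤ n → Nonempty (ChowGroup X.left 2 ≃+ ℤ))

/-- **Corollary (Chow-group form of (i)).** Under `Mboro2018_chowTwo_cubic`, for a smooth cubic
hypersurface `X ⊆ ℙⁿ⁺¹_k`, `n ≥ 7`, over an algebraically closed field of characteristic `0`, the
plane classes generate `CH₂(X)`: `AddSubgroup.closure (linearSubspaceClasses 2 (n + 1) i) = ⊤`.
[cite: Mboro2018, Cor. 0.6 (= arXiv:1701.04488 Intro. Cor. 6)] -/
theorem Mboro2018_chowTwo_cubic.closure_planeClasses_eq_top (h : Mboro2018_chowTwo_cubic.{u})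
    {k : Type u} [Field k] [IsAlgClosed k] [CharZero k] {n : ℕ} {X : SchemeOver k}
    (F : MvPolynomial (Fin (n + 1 + 1)) k) (i : X ⟶ projectiveSpace (n + 1) k)
    (hX : IsSmoothProjective n X) (hF : F.IsHomogeneous 3) (hirr : Irreducible F)
    [hi : IsClosedImmersion i.left]
    (hV : Set.range i.left.base =
      ProjectiveSpectrum.zeroLocus (MvPolynomial.homogeneousSubmodule (Fin (n + 1 + 1)) k) {F})
    (hn : 7 ≤ n) :
    AddSubgroup.closure (linearSubspaceClasses 2 (n + 1) i) = ⊤ :=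
  ((h n F i hX hF hirr hi hV).1 hn).closure_eq_top

/-- **Corollary (every class of a `2`-cycle is a combination of planes).** Under
`Mboro2018_chowTwo_cubic`, for a smooth cubic hypersurface `X ⊆ ℙⁿ⁺¹_k`, `n ≥ 7`, over an
algebraically closed field of characteristic `0`, every `x ∈ CH₂(X)` is the class of an integral
combination of prime cycles of finitely many planes of `X`.
[cite: Mboro2018, Cor. 0.6 (= arXiv:1701.04488 Intro. Cor. 6)] -/
theorem Mboro2018_chowTwo_cubic.exists_eq_mk_sum (h : Mboro2018_chowTwo_cubic.{u})
    {k : Type u} [Field k] [IsAlgClosed k] [CharZero k] {n : ℕ} {X : SchemeOver k}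
    (F : MvPolynomial (Fin (n + 1 + 1)) k) (i : X ⟶ projectiveSpace (n + 1) k)
    (hX : IsSmoothProjective n X) (hF : F.IsHomogeneous 3) (hirr : Irreducible F)
    [hi : IsClosedImmersion i.left]
    (hV : Set.range i.left.base =
      ProjectiveSpectrum.zeroLocus (MvPolynomial.homogeneousSubmodule (Fin (n + 1 + 1)) k) {F})
    (hn : 7 ≤ n) (x : ChowGroup X.left 2) :
    ∃ (s : Finset ↥X.left) (w : ↥X.left → ℤ) (hs : ∀ z ∈ s, IsLinearSubspacePoint 2 (n + 1) i z),
      x = ChowGroup.mk X.left 2 ⟨∑ z ∈ s, w z • primeCycle z,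
        sum_zsmul_primeCycle_mem_cyclesOfDim_of_isLinearSubspacePoint w hs⟩ :=
  exists_eq_mk_sum_of_mem_closure_linearSubspaceClasses
    ((h.closure_planeClasses_eq_top F i hX hF hirr hV hn).symm ▸ AddSubgroup.mem_top x)

/-- The exposed-witness hypotheses of the fact, together with reducedness of `X` (automatic for
smooth `X`; taken here as the hypothesis `hred`), are exactly the tree's notion
`IsSmoothHypersurface n 3 X` of a smooth cubic hypersurface. [folklore] -/
theorem isSmoothHypersurface_of_witnesses {k : Type u} [Field k] {n : ℕ} {X : SchemeOver k}
    (F : MvPolynomial (Fin (n + 1 + 1)) k) (i : X ⟶ projectiveSpace (n + 1) k)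
    (hX : IsSmoothProjective n X) (hF : F.IsHomogeneous 3) (hirr : Irreducible F)
    (hred : IsReduced X.left) [hi : IsClosedImmersion i.left]
    (hV : Set.range i.left.base =
      ProjectiveSpectrum.zeroLocus (MvPolynomial.homogeneousSubmodule (Fin (n + 1 + 1)) k) {F}) :
    IsSmoothHypersurface n 3 X :=
  ⟨hX, F, hF, hirr, hred, i, hi, hV⟩

/-- **Corollary (from `IsSmoothHypersurface`).** Under `Mboro2018_chowTwo_cubic`, a smooth cubic
hypersurface `X` of dimension `n ≥ 7` over an algebraically closed field of characteristic `0`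
(`IsSmoothHypersurface n 3 X`, the hypothesis of the route `ConiveauLadderCubicEightfolds`) has
`CH₂(X)` generated by the planes of `X ⊆ ℙⁿ⁺¹` for the closed immersion `i : X ↪ ℙⁿ⁺¹_k`
witnessing the hypersurface structure. [cite: Mboro2018, Cor. 0.6 (= arXiv:1701.04488 Intro. Cor. 6)] -/
theorem Mboro2018_chowTwo_cubic.of_isSmoothHypersurface (h : Mboro2018_chowTwo_cubic.{u})
    {k : Type u} [Field k] [IsAlgClosed k] [CharZero k] {n : ℕ} {X : SchemeOver k}
    (hX : IsSmoothHypersurface n 3 X) (hn : 7 ≤ n) :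
    ∃ i : X ⟶ projectiveSpace (n + 1) k, IsClosedImmersion i.left ∧
      ChowGeneratedByLinearSubspaces 2 (n + 1) i := by
  obtain ⟨hsp, F, hF, hirr, _, i, hi, hV⟩ := hX
  exact ⟨i, hi, (h n F i hsp hF hirr hi hV).1 hn⟩

/-- **Corollary (ii) (from `IsSmoothHypersurface`).** Under `Mboro2018_chowTwo_cubic`, a smooth cubic
hypersurface of dimension `n ≥ 9` over an algebraically closed field of characteristic `0` has
`CH₂(X) ≃ ℤ`. [cite: Mboro2018, Cor. 0.6 (= arXiv:1701.04488 Intro. Cor. 6)] -/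
theorem Mboro2018_chowTwo_cubic.nonempty_addEquiv_int (h : Mboro2018_chowTwo_cubic.{u})
    {k : Type u} [Field k] [IsAlgClosed k] [CharZero k] {n : ℕ} {X : SchemeOver k}
    (hX : IsSmoothHypersurface n 3 X) (hn : 9 ≤ n) : Nonempty (ChowGroup X.left 2 ≃+ ℤ) := by
  obtain ⟨hsp, F, hF, hirr, _, i, hi, hV⟩ := hX
  exact (h n F i hsp hF hirr hi hV).2 hn

end Literature.AlgebraicGeometry.Motives

end
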